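import Literature.MathematicalPhysics.QuantumFieldTheory.Balaban1983to89.B12TreeDecay
import Literature.MathematicalPhysics.QuantumFieldTheory.Balaban1983to89.B14Sect3

/-!
# `Balaban1983to89.B14.Eq348SecondClass` — T. Bałaban, *Convergent renormalization expansions for lattice gauge
# theories*, Commun. Math. Phys. **119** (1988) 243–285 [Balaban1988Convergent]: (3.48) and the sentence after it
# (p. 280) — the SUM over the second-class localization domains `X ∋ z`, `X ∩ (□^{∼2})ᶜ ≠ ∅`, is
# `≤ O(1)exp(−κ(LʲL⁻ⁿ)⁻¹) ≤ O(1)(LʲL⁻ⁿ)⁵` — PROVED with the O(1) explicit, from the inductive bound (I.1.18) and the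
# tree-decay summability (1.26) of [II] (`B12TreeDecay`)

statement-level skeleton of published theorems with citation tags; proofs where landed; nothing here is a claim about the Yang–Mills mass gap

PDF held: `paper:balaban1988-cmp119-convergent-renormalization` (journal page = PDF page + 242); pp. 279–280 [PDF 37–38] read
from the OCR text layer and (3.48) re-read as an image on the x2 render `…-p038-x2.png` of the cell `pub-balaban`
(the OCR layer's «exp(−κ((LʲL⁻ⁿ)⁻¹ − 1)?» of the ROWS informal cell is NOT what is printed: the display reads
`|𝐄^{(j)}(X, z)| ≦ E₀ exp(−κ(LʲL⁻ⁿ)⁻¹) exp(−½κd_j(X))`).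

CITATION HEADER (lean-in-tree rule).  WHAT IS REPRODUCED, verbatim.  [Balaban1988Convergent] p. 279: *"Let us assume
that z ∈ Λ_j∩(Ω_n∖Ω_{n+1}), and let us take the cube □ ∈ π_n such that z ∈ □. We represent the function 𝐄^{(j)}(Λ_j, z)
as the sum (2.27) over the localization domains X ∈ 𝐃_j, X ⊂ Λ_j, z ∈ X. Consider the two cases (I.3.5): X ⊂ □^{∼2},
X∩(□^{∼2})ᶜ ≠ ∅ (the ∼-operation is in the L⁻ⁿ-scale). In the second case the function 𝐄^{(j)}(X, z) is already very
small by the bound (I.1.18):"* p. 280: *"|𝐄^{(j)}(X, z)| ≦ E₀ exp(−κ(LʲL⁻ⁿ)⁻¹) exp(−½κd_j(X)). (3.48) In the proof of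
Theorem 2 we simply estimate all these terms using the above bound, and the sum over X is bounded by
O(1)exp(−κ(LʲL⁻ⁿ)⁻¹) ≦ O(1)(LʲL⁻ⁿ)⁵. This is an admissible error contributing only to the constant on the right-hand
side of (2.43)."*  [Balaban1987RG1] (1.18) p. 261: *"|𝐄^{(j)}(X, U′U_k(X))| ≦ E₀ exp(−κd_j(X))"*.  [Balaban1988RG2Cluster]
(1.26) p. 8: *"Σ_{X∈𝐃_j, X⊃□′} exp(−κd_j(X)) ≤ O(1), (1.26) for κ sufficiently large."*

SKELETON row (owner r11): **B14.Eq3.48** — so far `proved-existing (arithmetic core)` = the three scalar lemmas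
`B14Sect3.exp_split_348` (the splitting behind (3.48)), `exp_neg_mul_le_pow_inv`/`exp_neg_inv_le_pow_five` (the last
inequality `exp(−κ/s) ≤ (5/κ)⁵e⁻⁵s⁵`), while *"the sum over X is bounded by O(1)exp(−κ(LʲL⁻ⁿ)⁻¹)"* — the use of the
tree-decay summability — was *"typed inside `B14Sect3.Rep367` hypotheses"* only.  THIS FILE proves the two-member chain
of p. 280 on the tree's carrier of localization domains of one scale (`B12TreeDecay.CubeSystem S`: the cubes of `π_j`,
wall adjacency, the connected families `X ∈ 𝐃_j`, the tree length `S.dj`), with every O(1) explicit: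
* `ineq348_of_118` — (3.48) for ONE domain of the second class from (I.1.18) and the geometry of the class
  (`2(LʲL⁻ⁿ)⁻¹ ≤ d_j(X)`);
* `secondClass_sum_le` — *"the sum over X is bounded by O(1)exp(−κ(LʲL⁻ⁿ)⁻¹)"*: over the domains above the cube of `z`
  whose tree length is `≥ 2D`, `D = (LʲL⁻ⁿ)⁻¹`: `Σ_X |𝐄^{(j)}(X, z)| ≤ E₀·K₀(c₀,Δ)·exp(−κD)` for `κ/2 ≥ κ₀(c₀,Δ)`, by
  (1.26) at `κ/2` (`B12TreeDecay.ineq126_of_volumeLeaf`, modulo its one quoted geometric leaf `VolumeLeaf c₀` and the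
  degree bound `DegreeLE Δ`, exactly as there);
* `secondClass_sum_le_pow_five` — *"≦ O(1)(LʲL⁻ⁿ)⁵"* with `O(1) = E₀K₀(c₀,Δ)(5/κ)⁵e⁻⁵`;
* `secondClass_admissible`/`abs_secondClass_sum_le` — *"an admissible error contributing only to the constant on the
  right-hand side of (2.43)"*: for `s = LʲL⁻ⁿ ≤ 1` and `b ≥ 0`, `s⁵ ≤ s^{5−b}` (`pow_five_le_rpow`), so the second-class sum
  is a (3.67)/`B14Sect3.Rep367`-shaped per-point term `c·(L^{j−n})^{5−b}` with `c = E₀K₀(5/κ)⁵e⁻⁵`.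
Model notes (declared): (M1) the second class is carried as the sub-family `{X ∋ □_z : 2D ≤ d_j(X)}` — the implication
«X ∩ (□^{∼2})ᶜ ≠ ∅ ⇒ d_j(X) ≥ 2(LʲL⁻ⁿ)⁻¹» is cube geometry of the π_n/π_j partitions (X connected, contains the π_j-cube of
z inside □ and a cube outside □^{∼2}, two π_n-layers away), not modelled on `CubeSystem` (DIVERGENCE F5 of `Setup`/
`B12TreeDecay`: distances abstract) — it enters as the hypothesis `hclass`; (M2) (I.1.18) enters as the hypothesis `h118`
on the real numbers `E X = 𝐄^{(j)}(X, U_k, z)` (the analyticity domains play no role in this counting step).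
Theorems only; no `sorry`.

Mega-formalization `lit-balaban`, unit `lit-balaban-r11` gen 5 (B14 fold owner), HOME `run/shared/lean/pub/lit-balaban/`.

## References
* [Balaban1988Convergent] T. Bałaban, Commun. Math. Phys. 119 (1988) 243–285, (3.48) p.280.
* [Balaban1987RG1] T. Bałaban, Commun. Math. Phys. 109 (1987) 249–301 ([I]: (1.18) p.261, (3.5) p.275).
* [Balaban1988RG2Cluster] T. Bałaban, Commun. Math. Phys. 116 (1988) 1–22 ([II]: (1.26) p.8).
-/

namespace Literature.MathematicalPhysics.QuantumFieldTheory.Balaban1983to89.B14.Eq348SecondClass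

open Finset
open Literature.MathematicalPhysics.QuantumFieldTheory.Balaban1983to89
open Literature.MathematicalPhysics.QuantumFieldTheory.Balaban1983to89.B12TreeDecay

variable {S : LocDomainSys} (G : CubeSystem S)

/-- **(3.48) for one second-class domain** (p. 280): from (I.1.18) `|𝐄^{(j)}(X, z)| ≤ E₀exp(−κd_j(X))` and the geometry
of the second class `d_j(X) ≥ 2(LʲL⁻ⁿ)⁻¹ = 2D`: `|𝐄^{(j)}(X, z)| ≤ E₀ exp(−κD) exp(−½κd_j(X))`.
[cite: Balaban1988Convergent, (3.48) p.280] -/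
theorem ineq348_of_118 {E : S.Dom → ℝ} {E₀ κ D : ℝ} (hE₀ : 0 ≤ E₀) (hκ : 0 ≤ κ)
    (h118 : ∀ X, |E X| ≤ E₀ * Real.exp (-κ * S.dj X)) {X : S.Dom} (hX : 2 * D ≤ S.dj X) :
    |E X| ≤ E₀ * Real.exp (-(κ * D)) * Real.exp (-(κ * S.dj X / 2)) := by
  have h := B14Sect3.exp_split_348 κ (S.dj X) D hκ hX
  calc |E X| ≤ E₀ * Real.exp (-κ * S.dj X) := h118 X
    _ = E₀ * Real.exp (-(κ * S.dj X)) := by rw [neg_mul]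
    _ ≤ E₀ * (Real.exp (-(κ * D)) * Real.exp (-(κ * S.dj X / 2))) := mul_le_mul_of_nonneg_left h hE₀
    _ = E₀ * Real.exp (-(κ * D)) * Real.exp (-(κ * S.dj X / 2)) := by ring

/-- **"the sum over X is bounded by O(1)exp(−κ(LʲL⁻ⁿ)⁻¹)"** (p. 280): over the second-class domains above the cube `□_z ∋ z`
(those with `d_j(X) ≥ 2D`, `D = (LʲL⁻ⁿ)⁻¹`), `Σ_X |𝐄^{(j)}(X, z)| ≤ E₀·K₀(c₀,Δ)·exp(−κD)` whenever `κ/2 ≥ κ₀(c₀,Δ)` — (3.48)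
termwise and the tree-decay summability (1.26) of [II] at `κ/2` (`B12TreeDecay.ineq126_of_volumeLeaf`, constants
`κ₀ = c₀·log(2(Δ+1)²)`, `K₀ = e^{κ₀}(Δ+1)⁻²`, modulo its quoted leaf `VolumeLeaf c₀` and the degree bound `DegreeLE Δ`).
[cite: Balaban1988Convergent, (3.48) p.280] -/
theorem secondClass_sum_le {Δ : ℕ} (hΔ : G.DegreeLE Δ) {c₀ : ℝ} (hV : G.VolumeLeaf c₀)
    {E : S.Dom → ℝ} {E₀ κ D : ℝ} (hE₀ : 0 ≤ E₀) (hκ : kappa₀ c₀ Δ ≤ κ / 2) (hκ0 : 0 ≤ κ)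
    (h118 : ∀ X, |E X| ≤ E₀ * Real.exp (-κ * S.dj X)) (cz : G.Cube)
    (second : S.Dom → Prop) [DecidablePred second] (hclass : ∀ X ∈ G.above cz, second X → 2 * D ≤ S.dj X) :
    ∑ X ∈ (G.above cz).filter second, |E X| ≤ E₀ * K₀ c₀ Δ * Real.exp (-(κ * D)) := by
  have h126 := ineq126_of_volumeLeaf G hΔ hV hκ cz
  have hK : 0 ≤ E₀ * Real.exp (-(κ * D)) := mul_nonneg hE₀ (Real.exp_nonneg _)
  calc ∑ X ∈ (G.above cz).filter second, |E X|
      ≤ ∑ X ∈ (G.above cz).filter second, E₀ * Real.exp (-(κ * D)) * Real.exp (-(κ / 2) * S.dj X) := by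
        refine Finset.sum_le_sum fun X hX => ?_
        rw [Finset.mem_filter] at hX
        have h := ineq348_of_118 (S := S) hE₀ hκ0 h118 (hclass X hX.1 hX.2)
        have e : -(κ * S.dj X / 2) = -(κ / 2) * S.dj X := by ring
        rwa [e] at h
    _ = E₀ * Real.exp (-(κ * D)) * ∑ X ∈ (G.above cz).filter second, Real.exp (-(κ / 2) * S.dj X) := by
        rw [Finset.mul_sum]
    _ ≤ E₀ * Real.exp (-(κ * D)) * ∑ X ∈ G.above cz, Real.exp (-(κ / 2) * S.dj X) :=
        mul_le_mul_of_nonneg_left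
          (Finset.sum_le_sum_of_subset_of_nonneg (Finset.filter_subset _ _) fun X _ _ => Real.exp_nonneg _) hK
    _ ≤ E₀ * Real.exp (-(κ * D)) * K₀ c₀ Δ := mul_le_mul_of_nonneg_left h126 hK
    _ = E₀ * K₀ c₀ Δ * Real.exp (-(κ * D)) := by ring

/-- **"≦ O(1)(LʲL⁻ⁿ)⁵"** (p. 280): with `D = s⁻¹`, `s = LʲL⁻ⁿ > 0`, the second-class sum is `≤ E₀K₀(c₀,Δ)(5/κ)⁵e⁻⁵ · s⁵`
(`B14Sect3.exp_neg_inv_le_pow_five`; needs `κ > 0`). [cite: Balaban1988Convergent, (3.48) p.280] -/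
theorem secondClass_sum_le_pow_five {Δ : ℕ} (hΔ : G.DegreeLE Δ) {c₀ : ℝ} (hV : G.VolumeLeaf c₀)
    {E : S.Dom → ℝ} {E₀ κ s : ℝ} (hE₀ : 0 ≤ E₀) (hκ : kappa₀ c₀ Δ ≤ κ / 2) (hκ0 : 0 < κ) (hs : 0 < s)
    (h118 : ∀ X, |E X| ≤ E₀ * Real.exp (-κ * S.dj X)) (cz : G.Cube)
    (second : S.Dom → Prop) [DecidablePred second] (hclass : ∀ X ∈ G.above cz, second X → 2 * s⁻¹ ≤ S.dj X) :
    ∑ X ∈ (G.above cz).filter second, |E X|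
      ≤ E₀ * K₀ c₀ Δ * (((5 : ℝ) / κ) ^ 5 * Real.exp (-(5 : ℝ))) * s ^ 5 := by
  have h1 := secondClass_sum_le G hΔ hV hE₀ hκ hκ0.le h118 cz second hclass
  have h2 := B14Sect3.exp_neg_inv_le_pow_five κ s hκ0 hs
  have hK : 0 ≤ E₀ * K₀ c₀ Δ := mul_nonneg hE₀ (K₀_pos c₀ Δ).le
  calc ∑ X ∈ (G.above cz).filter second, |E X| ≤ E₀ * K₀ c₀ Δ * Real.exp (-(κ * s⁻¹)) := h1
    _ ≤ E₀ * K₀ c₀ Δ * (((5 : ℝ) / κ) ^ 5 * Real.exp (-(5 : ℝ)) * s ^ 5) := mul_le_mul_of_nonneg_left h2 hK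
    _ = E₀ * K₀ c₀ Δ * (((5 : ℝ) / κ) ^ 5 * Real.exp (-(5 : ℝ))) * s ^ 5 := by ring

/-- For `0 < s ≤ 1` and `0 ≤ b`, `s⁵ ≤ s^{5−b}` — so an `O(s⁵)` error is an `O(s^{5−β})` one, *"an admissible error
contributing only to the constant on the right-hand side of (2.43)"*. [folklore] -/
private theorem pow_five_le_rpow {s b : ℝ} (hs : 0 < s) (hs1 : s ≤ 1) (hb : 0 ≤ b) : s ^ 5 ≤ s ^ ((5 : ℝ) - b) := by
  have h : s ^ ((5 : ℝ)) ≤ s ^ ((5 : ℝ) - b) :=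
    Real.rpow_le_rpow_of_exponent_ge hs hs1 (by linarith)
  have e : s ^ ((5 : ℝ)) = s ^ 5 := by exact_mod_cast Real.rpow_natCast s 5
  rw [e] at h
  exact h

/-- **"This is an admissible error contributing only to the constant on the right-hand side of (2.43)"** (p. 280): for
`s = LʲL⁻ⁿ ∈ (0, 1]` (j ≤ n) and any `b ≥ 0` the second-class sum is `≤ E₀K₀(5/κ)⁵e⁻⁵ · s^{5−b}` — a term of the per-point
shape `c·(L^{j−n})^{5−β′}` consumed by `B14Sect3.Rep367`/`ineq243_of_rep367`. [cite: Balaban1988Convergent, (3.48) p.280] -/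
theorem secondClass_admissible {Δ : ℕ} (hΔ : G.DegreeLE Δ) {c₀ : ℝ} (hV : G.VolumeLeaf c₀)
    {E : S.Dom → ℝ} {E₀ κ s b : ℝ} (hE₀ : 0 ≤ E₀) (hκ : kappa₀ c₀ Δ ≤ κ / 2) (hκ0 : 0 < κ) (hs : 0 < s) (hs1 : s ≤ 1)
    (hb : 0 ≤ b) (h118 : ∀ X, |E X| ≤ E₀ * Real.exp (-κ * S.dj X)) (cz : G.Cube)
    (second : S.Dom → Prop) [DecidablePred second] (hclass : ∀ X ∈ G.above cz, second X → 2 * s⁻¹ ≤ S.dj X) :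
    ∑ X ∈ (G.above cz).filter second, |E X|
      ≤ E₀ * K₀ c₀ Δ * (((5 : ℝ) / κ) ^ 5 * Real.exp (-(5 : ℝ))) * s ^ ((5 : ℝ) - b) := by
  have hK : 0 ≤ E₀ * K₀ c₀ Δ * (((5 : ℝ) / κ) ^ 5 * Real.exp (-(5 : ℝ))) :=
    mul_nonneg (mul_nonneg hE₀ (K₀_pos c₀ Δ).le) (mul_nonneg (pow_nonneg (div_nonneg (by norm_num) hκ0.le) 5)
      (Real.exp_nonneg _))
  exact (secondClass_sum_le_pow_five G hΔ hV hE₀ hκ hκ0 hs h118 cz second hclass).trans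
    (mul_le_mul_of_nonneg_left (pow_five_le_rpow hs hs1 hb) hK)

/-- The signed sum is bounded by the sum of absolute values: `|Σ_X 𝐄^{(j)}(X, z)| ≤ E₀K₀(5/κ)⁵e⁻⁵ s^{5−b}` for the second
class — the form in which the second-class terms of (2.27) enter the difference `𝐄^{(j)}(Λ_j, U_k, z) − 𝐄^{(j)}(Λ_j, 1, z)`
(apply to `E X = 𝐄^{(j)}(X, U_k, z) − 𝐄^{(j)}(X, 1, z)` with `2E₀`). [cite: Balaban1988Convergent, (3.48) p.280] -/
theorem abs_secondClass_sum_le {Δ : ℕ} (hΔ : G.DegreeLE Δ) {c₀ : ℝ} (hV : G.VolumeLeaf c₀)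
    {E : S.Dom → ℝ} {E₀ κ s b : ℝ} (hE₀ : 0 ≤ E₀) (hκ : kappa₀ c₀ Δ ≤ κ / 2) (hκ0 : 0 < κ) (hs : 0 < s) (hs1 : s ≤ 1)
    (hb : 0 ≤ b) (h118 : ∀ X, |E X| ≤ E₀ * Real.exp (-κ * S.dj X)) (cz : G.Cube)
    (second : S.Dom → Prop) [DecidablePred second] (hclass : ∀ X ∈ G.above cz, second X → 2 * s⁻¹ ≤ S.dj X) :
    |∑ X ∈ (G.above cz).filter second, E X|
      ≤ E₀ * K₀ c₀ Δ * (((5 : ℝ) / κ) ^ 5 * Real.exp (-(5 : ℝ))) * s ^ ((5 : ℝ) - b) :=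
  (Finset.abs_sum_le_sum_abs _ _).trans (secondClass_admissible G hΔ hV hE₀ hκ hκ0 hs hs1 hb h118 cz second hclass)

end Literature.MathematicalPhysics.QuantumFieldTheory.Balaban1983to89.B14.Eq348SecondClass
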